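import Summits.FinalStateConjecture.FinalStateConjecture.Theorems.SwallowTheDatumParametricKerrBurialLine
import Literature.Geometry.Lorentzian.SmoothDataFamilyLocal
import Mathlib.Geometry.Manifold.PartitionOfUnity

/-!
# Route StarvedNecks — crux `HonestFixedRadiusSettling`, line `far-field-surgery`:
# stub `stub_thresholdJunction` (the threshold-junction lemma C)

The registered stub C of the line skeleton `Cruxes/HonestFixedRadiusSettling/Lines/far_field_surgery.lean`,
proved.  It is the tree's junction lemma `ParametricKerrBurial.junction`
(`Theorems/SwallowTheDatumParametricKerrBurialLine.lean` §1) WITH A THRESHOLD: a radius–breathing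
2-family `S (R, t)` of initial data on the `3`-manifold `X`, jointly smooth on `{R⋆ < R} × ℝ × X`,
agreeing off the far region `e.far R` of an asymptotically flat end `e` with a smooth comparison family
`E t` (`E 0 = d`) whose MARKER `t ↦ h_{E t}(x₀)(v₀, v₀)` at a point `x₀ ∉ e.far R⋆` is injective on
`(−1, 1)`, and ANY threshold `ρ : ℝ → ℝ` continuous on `{t ≠ 0}`, reparametrise into a typed smooth
(`InitialDataSet.IsSmoothDataFamily 1`) injective one-parameter family `F` through `d` whose members
`F c`, `c ≠ 0`, are members `S (R, t)` ABOVE THE THRESHOLD: `R⋆ < R`, `ρ t ≤ R`, `0 < |t| < 1`.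

Proof.  `F 0 := d` and `F c := S (R c, t c)` for `c ≠ 0`, with the tree's breathing amplitude
`t c := angleOf c = arctan(c₀)/2` (smooth, injective, `≠ 0` off `0`, `|t c| < π/4 < 1`) and the radius
`R c := R⋆ + 1 + ‖c‖⁻² + μ c`, where `μ` is a smooth majorant, on the open set `{c ≠ 0}`, of the
continuous function `max (ρ (t c) − (R⋆ + 1 + ‖c‖⁻²)) 0` (smooth partitions of unity on the open
submanifold `{c ≠ 0}` of `ℝ¹`: Mathlib's `exists_contMDiffMap_forall_mem_convex_of_local_const`;
`exists_contDiffOn_majorant` below).  Hence `ρ (t c) ≤ R c`, `R⋆ < R⋆ + 1 + ‖c‖⁻² ≤ R c`, and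
`R c → ∞` as `c → 0`.  Smoothness of the two section maps `(c, x) ↦ h_{F c}(x), k_{F c}(x)`
(`contMDiff_thresholdFamily_section`, verbatim the tree's `contMDiff_family_section` with the new
radius): off `c = 0` by composition with the smooth parameter map `(c, x) ↦ ((R c, t c), x)`; at
`(0, x)` by LOCAL EXHAUSTION — a neighbourhood `V` of `x` misses `e.far R` for all `R ≥ ρ₀`
(`AFEnd.exists_nhds_forall_not_mem_far`), and `R c ≥ ρ₀` for `‖c‖` small, so near `(0, x)` the
section of `F c` is that of `E (t c)`, jointly smooth in `(c, x)` with `E (t 0) = E 0 = d = F 0`.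
Injectivity: read the marker at `x₀` (`x₀ ∉ e.far R⋆ ⊇ e.far (R c)`, so
`h_{F c}(x₀)(v₀, v₀) = h_{E (t c)}(x₀)(v₀, v₀)`, injective in `t c ∈ (−1, 1)`, and `t` is injective).

No definitions, no named facts; standard axioms.

References: R. Bartnik, Comm. Pure Appl. Math. 39 (1986), §1 (the exhaustion by far regions);
D. Christodoulou, CQG 16 (1999), p. A24 (one-parameter families through a datum).
-/

-- the doubled `FinalStateConjecture` path component is the summit/problem naming scheme, not a mistake
set_option linter.dupNamespace false

noncomputable section

namespace Summit.FinalStateConjecture.FinalStateConjecture.Theorems.StarvedNecks.FarFieldSurgery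

open scoped Manifold ContDiff Topology
open Bundle Set Filter Function Literature.Geometry.Lorentzian
open Summit.FinalStateConjecture.FinalStateConjecture.Theorems.SwallowTheDatum.ParametricKerrBurial
  (SmoothSectionsOn AgreeAt radiusOf angleOf radiusOf_gt contDiffOn_radiusOf lt_inv_norm_sq
    contDiff_angleOf angleOf_zero angleOf_mem_Ioo angleOf_injective contMDiff_compMap)

/-! ## A smooth majorant of a continuous function on an open set -/

/-- **Smooth majorants on open sets.** A real function continuous on an open subset `U` of a
finite-dimensional real normed space is bounded above on `U` by a function smooth on `U`: on the
open submanifold `U` the constraint sets `[f y, ∞)` are convex and the constant `f x + 1` is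
admissible near `x`, so Mathlib's `exists_contMDiffMap_forall_mem_convex_of_local_const` (smooth
partitions of unity on the σ-compact Hausdorff manifold `U`) gives a smooth `g ≥ f` on `U`; extended
by `0`, it is smooth on `U` as a function on the ambient space (`contMDiffAt_subtype_iff`). [folklore] -/
theorem exists_contDiffOn_majorant {V : Type*} [NormedAddCommGroup V] [NormedSpace ℝ V]
    [FiniteDimensional ℝ V] {U : Set V} (hU : IsOpen U) {f : V → ℝ} (hf : ContinuousOn f U) :
    ∃ g : V → ℝ, ContDiffOn ℝ ∞ g U ∧ ∀ x ∈ U, f x ≤ g x := by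
  classical
  let U' : TopologicalSpace.Opens V := ⟨U, hU⟩
  haveI : LocallyCompactSpace U' := hU.locallyCompactSpace
  have hf' : Continuous fun y : U' ↦ f y := hf.comp_continuous continuous_subtype_val fun y ↦ y.2
  obtain ⟨g, hg⟩ := exists_contMDiffMap_forall_mem_convex_of_local_const 𝓘(ℝ, V) (M := U')
    (n := (⊤ : ℕ∞)) (t := fun y : U' ↦ Set.Ici (f y)) (fun y ↦ convex_Ici _) fun y ↦
      ⟨f y + 1, (hf'.continuousAt.eventually_lt continuousAt_const (lt_add_one (f y))).mono
        fun z hz ↦ Set.mem_Ici.2 hz.le⟩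
  -- extend `g` by `0` off `U`
  obtain ⟨μ, hμ⟩ : ∃ μ : V → ℝ, ∀ y : U', μ y = g y :=
    ⟨fun x ↦ if hx : x ∈ U then g ⟨x, hx⟩ else 0, fun y ↦ dif_pos y.2⟩
  refine ⟨μ, fun x hx ↦ ?_, fun x hx ↦ ?_⟩
  · -- smooth at `x ∈ U`: on the open submanifold `U` the extension IS `g`
    have h1 : ContMDiffAt 𝓘(ℝ, V) 𝓘(ℝ, ℝ) ∞ (fun y : U' ↦ μ y) (⟨x, hx⟩ : U') := by
      rw [show (fun y : U' ↦ μ y) = g from funext hμ]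
      exact g.contMDiff _
    have h2 : ContMDiffAt 𝓘(ℝ, V) 𝓘(ℝ, ℝ) ∞ μ x :=
      (contMDiffAt_subtype_iff (U := U') (f := μ) (x := (⟨x, hx⟩ : U'))).1 h1
    exact (contMDiffAt_iff_contDiffAt.1 h2).contDiffWithinAt
  · have h3 := hg ⟨x, hx⟩
    rw [← hμ ⟨x, hx⟩] at h3
    exact h3

/-! ## The threshold family: smoothness of one section -/

section Threshold

variable {X : Type} [TopologicalSpace X] [ChartedSpace E3 X] [IsManifold (𝓡 3) ∞ X]

/-- Core of the threshold-junction lemma for ONE section selector `σ` (`h` or `k`), verbatim the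
tree's `ParametricKerrBurial.contMDiff_family_section` with a general radius map `Rof ≥ radiusOf R⋆`
smooth off `c = 0`: the section of a family `F` with `F 0 = d`, `F c = S (Rof c, angleOf c)` for
`c ≠ 0`, is jointly smooth in `(c, x)` — off `c = 0` by composition with the parameter map, at `c = 0`
by local exhaustion (`AFEnd.exists_nhds_forall_not_mem_far`) and eventual agreement with the
comparison family. [folklore] -/
theorem contMDiff_thresholdFamily_section (d : InitialDataSet (𝓡 3) X) (e : AFEnd X) (Rstar : ℝ)
    (S : ℝ × ℝ → InitialDataSet (𝓡 3) X) (E : ℝ → InitialDataSet (𝓡 3) X)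
    (Rof : EuclideanSpace ℝ (Fin 1) → ℝ) (F : EuclideanSpace ℝ (Fin 1) → InitialDataSet (𝓡 3) X)
    (σ : InitialDataSet (𝓡 3) X → (x : X) → (TangentSpace (𝓡 3) x →L[ℝ] TangentSpace (𝓡 3) x →L[ℝ] ℝ))
    (hRof : ContDiffOn ℝ ∞ Rof {c : EuclideanSpace ℝ (Fin 1) | c ≠ 0})
    (hle : ∀ c : EuclideanSpace ℝ (Fin 1), c ≠ 0 → radiusOf Rstar c ≤ Rof c)
    (hF0 : F 0 = d) (hF : ∀ c : EuclideanSpace ℝ (Fin 1), c ≠ 0 → F c = S (Rof c, angleOf c))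
    (hS : ContMDiffOn ((𝓘(ℝ, ℝ).prod 𝓘(ℝ, ℝ)).prod (𝓡 3)) ((𝓡 3).prod 𝓘(ℝ, E3 →L[ℝ] E3 →L[ℝ] ℝ)) ∞
      (fun p : (ℝ × ℝ) × X ↦
        TotalSpace.mk' (F := E3 →L[ℝ] E3 →L[ℝ] ℝ)
          (E := fun x : X ↦ TangentSpace (𝓡 3) x →L[ℝ] TangentSpace (𝓡 3) x →L[ℝ] ℝ) p.2
          (σ (S p.1) p.2)) {p | Rstar < p.1.1})
    (hE : ContMDiffOn (𝓘(ℝ, ℝ).prod (𝓡 3)) ((𝓡 3).prod 𝓘(ℝ, E3 →L[ℝ] E3 →L[ℝ] ℝ)) ∞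
      (fun p : ℝ × X ↦
        TotalSpace.mk' (F := E3 →L[ℝ] E3 →L[ℝ] ℝ)
          (E := fun x : X ↦ TangentSpace (𝓡 3) x →L[ℝ] TangentSpace (𝓡 3) x →L[ℝ] ℝ) p.2
          (σ (E p.1) p.2)) Set.univ)
    (hE0 : ∀ x, σ (E 0) x = σ d x)
    (hSE : ∀ R t : ℝ, Rstar < R → ∀ x ∉ e.far R, σ (S (R, t)) x = σ (E t) x) :
    ContMDiff (𝓘(ℝ, EuclideanSpace ℝ (Fin 1)).prod (𝓡 3)) ((𝓡 3).prod 𝓘(ℝ, E3 →L[ℝ] E3 →L[ℝ] ℝ)) ∞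
      (fun q : EuclideanSpace ℝ (Fin 1) × X ↦
        TotalSpace.mk' (F := E3 →L[ℝ] E3 →L[ℝ] ℝ)
          (E := fun x : X ↦ TangentSpace (𝓡 3) x →L[ℝ] TangentSpace (𝓡 3) x →L[ℝ] ℝ) q.2
          (σ (F q.1) q.2)) := by
  have hgt : ∀ c : EuclideanSpace ℝ (Fin 1), c ≠ 0 → Rstar < Rof c := fun c hc ↦
    (radiusOf_gt Rstar c).trans_le (hle c hc)
  rintro ⟨c, x⟩
  by_cases hc : c = 0
  · -- at the junction: agree with the comparison family near `(0, x)`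
    subst hc
    have hcomp := contMDiffOn_univ.1
      (hE.comp contMDiff_compMap.contMDiffOn (fun _ _ ↦ Set.mem_univ _) (s := Set.univ))
    apply (hcomp (0, x)).congr_of_eventuallyEq
    obtain ⟨V, hV, ρ₀, hVρ⟩ :=
      Summit.FinalStateConjecture.FinalStateConjecture.Theorems.SwallowTheDatum.AFEnd.exists_nhds_forall_not_mem_far
        e x
    set ρ₃ : ℝ := max (ρ₀ - Rstar - 1) 1 with hρ₃
    have hρ₃1 : 1 ≤ ρ₃ := le_max_right _ _
    have hε : 0 < min 1 ρ₃⁻¹ := lt_min one_pos (inv_pos.2 (by linarith))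
    have hN : Metric.ball (0 : EuclideanSpace ℝ (Fin 1)) (min 1 ρ₃⁻¹) ×ˢ V ∈
        𝓝 ((0 : EuclideanSpace ℝ (Fin 1)), x) :=
      prod_mem_nhds (Metric.ball_mem_nhds _ hε) hV
    filter_upwards [hN] with q ⟨hq1, hq2⟩
    rw [Metric.mem_ball, dist_zero_right] at hq1
    by_cases hq0 : q.1 = 0
    · simp only [Function.comp_apply, hq0, hF0, angleOf_zero, hE0]
    · have hfar : q.2 ∉ e.far (Rof q.1) := by
        refine hVρ _ ?_ _ hq2
        have := lt_inv_norm_sq hq0 hρ₃1 (lt_of_lt_of_le hq1 (min_le_left _ _))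
          (lt_of_lt_of_le hq1 (min_le_right _ _))
        have h' : ρ₀ - Rstar - 1 ≤ ρ₃ := le_max_left _ _
        have h'' := hle q.1 hq0
        unfold radiusOf at h''
        linarith
      simp only [Function.comp_apply, hF q.1 hq0, hSE _ _ (hgt q.1 hq0) _ hfar]
  · -- off the junction: composition with the parameter map `(c, x) ↦ ((Rof c, angleOf c), x)`
    have hopen : IsOpen {q : EuclideanSpace ℝ (Fin 1) × X | q.1 ≠ 0} :=
      isOpen_ne.preimage continuous_fst
    have hparam : ContMDiffOn (𝓘(ℝ, EuclideanSpace ℝ (Fin 1)).prod (𝓡 3))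
        ((𝓘(ℝ, ℝ).prod 𝓘(ℝ, ℝ)).prod (𝓡 3)) ∞
        (fun q : EuclideanSpace ℝ (Fin 1) × X ↦ ((Rof q.1, angleOf q.1), q.2)) {q | q.1 ≠ 0} :=
      ((hRof.contMDiffOn.comp contMDiffOn_fst fun _ hq ↦ hq).prodMk
        (contDiff_angleOf.contMDiff.comp_contMDiffOn contMDiffOn_fst)).prodMk contMDiffOn_snd
    have hcomp := hS.comp hparam (fun q hq ↦ hgt q.1 hq)
    exact (hcomp.congr fun q hq ↦ by simp only [Function.comp_apply, hF q.1 hq]).contMDiffAt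
      (hopen.mem_nhds hc)

end Threshold

/-! ## The registered stub -/

/-- **C — the threshold-junction lemma** (registered stub `stub_thresholdJunction` of the line
`far-field-surgery`, statement = the skeleton's `ThresholdJunction` verbatim).  A 2-family `S (R, t)`,
jointly smooth on `{R⋆ < R} × ℝ × X`, agreeing off `e.far R` with a smooth comparison family `E t`
(`E 0 = d`) whose marker `t ↦ h_{E t}(x₀)(v₀, v₀)` at `x₀ ∉ e.far R⋆` is injective on `(−1, 1)`, and
any threshold `ρ` continuous on `{t ≠ 0}`, reparametrise into a typed smooth injective one-parameter
family `F` through `d` whose members `F c`, `c ≠ 0`, are `S (R, t)` with `R⋆ < R`, `ρ t ≤ R`,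
`0 < |t| < 1`: `F c := S (R⋆ + 1 + ‖c‖⁻² + μ c, arctan(c₀)/2)` with `μ` a smooth majorant of
`max (ρ (arctan(c₀)/2) − R⋆ − 1 − ‖c‖⁻²) 0` on `{c ≠ 0}` (`exists_contDiffOn_majorant`), smooth by
`contMDiff_thresholdFamily_section`, injective by the marker read at `x₀`. [folklore] -/
theorem stub_thresholdJunction :
  ∀ (X : Type) [TopologicalSpace X] [ChartedSpace E3 X] [IsManifold (𝓡 3) ∞ X]
    (d : InitialDataSet (𝓡 3) X) (e : AFEnd X) (Rstar : ℝ) (S : ℝ × ℝ → InitialDataSet (𝓡 3) X)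
    (E : ℝ → InitialDataSet (𝓡 3) X) (x₀ : X) (v₀ : TangentSpace (𝓡 3) x₀) (ρ : ℝ → ℝ),
    SmoothSectionsOn (𝓘(ℝ, ℝ).prod 𝓘(ℝ, ℝ)) S {p : (ℝ × ℝ) × X | Rstar < p.1.1} →
    SmoothSectionsOn 𝓘(ℝ, ℝ) E (Set.univ : Set (ℝ × X)) → E 0 = d →
    (∀ R t : ℝ, Rstar < R → ∀ x ∉ e.far R, AgreeAt (S (R, t)) (E t) x) →
    x₀ ∉ e.far Rstar → Set.InjOn (fun t : ℝ ↦ (E t).h.inner x₀ v₀ v₀) (Set.Ioo (-1) 1) →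
    ContinuousOn ρ {t : ℝ | t ≠ 0} →
      ∃ F : EuclideanSpace ℝ (Fin 1) → InitialDataSet (𝓡 3) X,
        InitialDataSet.IsSmoothDataFamily 1 F ∧ F 0 = d ∧ Function.Injective F ∧
          ∀ c ≠ 0, ∃ R t : ℝ, Rstar < R ∧ ρ t ≤ R ∧ t ≠ 0 ∧ |t| < 1 ∧ F c = S (R, t) := by
  intro X _ _ _ d e Rstar S E x₀ v₀ ρ hS hE hE0 hSE hx₀ hmark hρ
  classical
  -- the amplitude `angleOf c = arctan(c₀)/2` vanishes only at `c = 0`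
  have hang : ∀ c : EuclideanSpace ℝ (Fin 1), c ≠ 0 → angleOf c ≠ 0 := fun c hc h0 ↦
    hc (angleOf_injective (h0.trans angleOf_zero.symm))
  -- Step 1: the radius map `Rof = radiusOf R⋆ + μ`, `μ` a smooth majorant on `{c ≠ 0}`
  obtain ⟨Rof, hRof, hle, hρle⟩ : ∃ Rof : EuclideanSpace ℝ (Fin 1) → ℝ,
      ContDiffOn ℝ ∞ Rof {c | c ≠ 0} ∧ (∀ c, c ≠ 0 → radiusOf Rstar c ≤ Rof c) ∧
        ∀ c, c ≠ 0 → ρ (angleOf c) ≤ Rof c := by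
    have hf : ContinuousOn
        (fun c : EuclideanSpace ℝ (Fin 1) ↦ max (ρ (angleOf c) - radiusOf Rstar c) 0) {c | c ≠ 0} := by
      exact (continuous_id.max continuous_const).comp_continuousOn
        ((hρ.comp contDiff_angleOf.continuous.continuousOn fun c hc ↦ hang c hc).sub
          (contDiffOn_radiusOf Rstar).continuousOn)
    obtain ⟨μ, hμ, hfμ⟩ := exists_contDiffOn_majorant isOpen_ne hf
    refine ⟨fun c ↦ radiusOf Rstar c + μ c, (contDiffOn_radiusOf Rstar).add hμ, fun c hc ↦ ?_,
      fun c hc ↦ ?_⟩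
    · have h1 := hfμ c hc
      have h2 := le_max_right (ρ (angleOf c) - radiusOf Rstar c) 0
      dsimp only
      linarith
    · have h1 := hfμ c hc
      have h2 := le_max_left (ρ (angleOf c) - radiusOf Rstar c) 0
      dsimp only
      linarith
  have hgt : ∀ c : EuclideanSpace ℝ (Fin 1), c ≠ 0 → Rstar < Rof c := fun c hc ↦
    (radiusOf_gt Rstar c).trans_le (hle c hc)
  -- Step 2: the family `F 0 = d`, `F c = S (Rof c, angleOf c)` for `c ≠ 0`
  obtain ⟨F, hF0, hF⟩ : ∃ F : EuclideanSpace ℝ (Fin 1) → InitialDataSet (𝓡 3) X,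
      F 0 = d ∧ ∀ c, c ≠ 0 → F c = S (Rof c, angleOf c) :=
    ⟨fun c ↦ if c = 0 then d else S (Rof c, angleOf c), if_pos rfl, fun c hc ↦ if_neg hc⟩
  refine ⟨F, ?_, hF0, ?_, fun c hc ↦ ⟨Rof c, angleOf c, hgt c hc, hρle c hc, hang c hc,
    abs_lt.2 (angleOf_mem_Ioo c), hF c hc⟩⟩
  · -- smooth family: both sections, by the one-selector core lemma
    refine ⟨contMDiff_thresholdFamily_section d e Rstar S E Rof F (fun D x ↦ D.h.inner x) hRof hle
        hF0 hF hS.1 hE.1 (fun x ↦ by rw [hE0]) (fun R t hR x hx ↦ (hSE R t hR x hx).1), ?_⟩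
    exact contMDiff_thresholdFamily_section d e Rstar S E Rof F (fun D x ↦ D.k x) hRof hle hF0 hF
        hS.2 hE.2 (fun x ↦ by rw [hE0]) (fun R t hR x hx ↦ (hSE R t hR x hx).2)
  · -- injective: read the marker at `x₀`
    intro c c' hcc'
    have hread : ∀ c : EuclideanSpace ℝ (Fin 1),
        (F c).h.inner x₀ v₀ v₀ = (E (angleOf c)).h.inner x₀ v₀ v₀ := by
      intro c
      by_cases hc : c = 0
      · subst hc
        rw [hF0, angleOf_zero, hE0]
      · have hfar : x₀ ∉ e.far (Rof c) := fun h ↦ hx₀ (e.far_mono (le_of_lt (hgt c hc)) h)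
        rw [hF c hc, (hSE _ _ (hgt c hc) x₀ hfar).1]
    have hm : (E (angleOf c)).h.inner x₀ v₀ v₀ = (E (angleOf c')).h.inner x₀ v₀ v₀ := by
      rw [← hread c, ← hread c', hcc']
    exact angleOf_injective (hmark (angleOf_mem_Ioo c) (angleOf_mem_Ioo c') hm)

end Summit.FinalStateConjecture.FinalStateConjecture.Theorems.StarvedNecks.FarFieldSurgery

end
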